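import Mathlib
import HarnessLib
import Summits.ResolutionOfSingularities.ResolutionOfSingularities.Theorems.WildQuotientsWildQuotientResolutionS1aValuative
import Summits.ResolutionOfSingularities.ResolutionOfSingularities.Theorems.WildQuotientsWildQuotientResolutionS1aAuxCharts
import Summits.ResolutionOfSingularities.ResolutionOfSingularities.Theorems.WildQuotientsWildQuotientResolutionS1aLocalAgree

/-!
# S1a — THE A SIDE AS ONE CENTRED VALUATION: `AuxValAt`, `AuxValWithinReach p ⇒ AuxWithinReachAux p`

[OURS · L1 W4.5c · lead-1 g9, SUCCESSOR-BRIEF-v1 §4 item 1 (D-VAL), A side] — NOT statements of the manuscript; counted 0; AI-level work, weaker than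
expert review. Crux stmt-ResolutionOfSingularities-17941 (`WildQuotients.CyclicQuotientFourfolds`), line `s1a-logminvertex` v10, registered research stub
`stub_auxWithinReachAux`. Route-independent. Companion of `…S1aValuative` (K side).

* `CentredVal.eq_valIdealSheaf_of_agree` — an ideal sheaf which agrees with the `d`-th valuation ideal sheaf on affine opens `Oᵢ` covering both its
  support and `closure {ξ}` IS the valuation ideal sheaf (both are `⊤` near every other point; ideal sheaves are determined locally,
  `LocalAgree.ideal_eq_of_locally_eq`).
* research def **`GameFrame.GModel.AuxValAt M`** (OURS CANDIDATE, asserted nowhere): a BAD point `ξ`, a valuation `v` centred at `ξ`, a degree `d > 0`,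
  finitely many `G`-stable affine CENTRE charts of the valuative Rees filtration covering `closure {ξ}`, a top-dimensional component of `nonKillable M`
  inside `closure {ξ}`, and: along every move of the valuative filtration in degree `d`, every bad point over `closure {ξ}` is KILLABLE.
  ★★ `auxChartsAt_of_auxValAt : AuxValAt M ⇒ AuxChartsAt M` (all charts carry one filtration: agreement `rfl`; the universally quantified agreeing
  `J` of `AuxChartsAt` has `J_d = 𝒥_d` by `eq_valIdealSheaf_of_agree`, so its moves are the valuation's own moves).
* `AuxValWithin n M` (bounded recursion with `AuxValAt` leaves) ⇒ `AuxChartsWithin n M`; research def **`AuxValWithinReach p`** (on AUX-reachable models)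
  and ★★ `auxWithinReachAux_of_auxValWithinReach : AuxValWithinReach p ⇒ AuxWithinReachAux p` (the registered A stub).
With `…S1aValuative`: BOTH registered research stubs are implied by "one centred valuation + charts" statements (`KillValReach`, `AuxValWithinReach`).
-/

set_option linter.dupNamespace false

noncomputable section

universe u

open CategoryTheory Limits AlgebraicGeometry TopologicalSpace Topology Opposite
open Literature.AlgebraicGeometry.Resolution Literature.AlgebraicGeometry.RelativeSpec
open Summit.ResolutionOfSingularities.ResolutionOfSingularities.Theorems.WildQuotientResolution.S1
open Summit.ResolutionOfSingularities.ResolutionOfSingularities.Theorems.WildQuotientResolution.S1.NodeAtlas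
open Summit.ResolutionOfSingularities.ResolutionOfSingularities.Theorems.WildQuotientResolution.S1.AuxCharts
open Summit.ResolutionOfSingularities.ResolutionOfSingularities.Theorems.WildQuotientResolution.S1.Valuative
open Summit.ResolutionOfSingularities.ResolutionOfSingularities.Theorems.WildQuotientResolution.S1.KillGlue

namespace Summit.ResolutionOfSingularities.ResolutionOfSingularities.Theorems.WildQuotientResolution.S1

namespace Valuative.CentredVal

variable {X : Scheme.{u}} {ξ : X} (c : CentredVal X ξ)

/-- ★ **An ideal sheaf agreeing with the `d`-th valuation ideal sheaf on affine opens covering its support and `closure {ξ}` is the valuation ideal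
sheaf** (near every other point both are `⊤`). [OURS · L1 W4.5c] -/
theorem eq_valIdealSheaf_of_agree {ι : Type*} (O : ι → X.Opens) (hO : ∀ i, IsAffineOpen (O i)) (J : X.IdealSheafData) {d : ℕ}
    (hagree : ∀ i, J.ideal ⟨O i, hO i⟩ = c.valIdeal d ⟨O i, hO i⟩) (hJ : (J.support : Set X) ⊆ ⋃ i, (O i : Set X))
    (hξ : closure {ξ} ⊆ ⋃ i, (O i : Set X)) : J = c.valIdealSheaf d := by
  refine Scheme.IdealSheafData.ext (funext fun U => LocalAgree.ideal_eq_of_locally_eq _ _ U fun x hxU => ?_)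
  by_cases hx : x ∈ ⋃ i, (O i : Set X)
  · obtain ⟨i, hxi⟩ := Set.mem_iUnion.mp hx
    exact ⟨⟨O i, hO i⟩, hxi, hagree i⟩
  · have hxJ : x ∉ (J.support : Set X) := fun h => hx (hJ h)
    have hxξ : x ∉ closure {ξ} := fun h => hx (hξ h)
    obtain ⟨_, ⟨U₀, hU₀, rfl⟩, hxU₀, hU₀sub⟩ :=
      X.isBasis_affineOpens.exists_subset_of_mem_open (Set.mem_compl hxξ) isClosed_closure.isOpen_compl
    have hξU₀ : ξ ∉ U₀ := fun h => hU₀sub h (subset_closure rfl)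
    have hz : x ∉ X.zeroLocus (U := U₀) (J.ideal ⟨U₀, hU₀⟩ : Set Γ(X, U₀)) := fun h =>
      hxJ ((Scheme.IdealSheafData.mem_support_iff_of_mem (I := J) (U := ⟨U₀, hU₀⟩) hxU₀).2 h)
    simp only [Scheme.mem_zeroLocus_iff, not_forall, not_not, exists_prop] at hz
    obtain ⟨f, hf, hxf⟩ := hz
    have hu : IsUnit ((X.presheaf.map (homOfLE <| X.basicOpen_le f).op).hom f) := by
      letI := hU₀.isLocalization_basicOpen f
      exact IsLocalization.map_units (M := Submonoid.powers f) Γ(X, X.basicOpen f) ⟨f, Submonoid.mem_powers f⟩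
    refine ⟨X.affineBasicOpen (U := ⟨U₀, hU₀⟩) f, hxf, ?_⟩
    have h1 : (c.valIdealSheaf d).ideal (X.affineBasicOpen (U := ⟨U₀, hU₀⟩) f) = ⊤ :=
      c.valIdeal_eq_top_of_not_mem (U := X.affineBasicOpen (U := ⟨U₀, hU₀⟩) f) (fun h => hξU₀ (X.basicOpen_le f h))
    have h2 : J.ideal (X.affineBasicOpen (U := ⟨U₀, hU₀⟩) f) = ⊤ := by
      rw [← J.map_ideal_basicOpen]
      exact Ideal.eq_top_of_isUnit_mem _ (Ideal.mem_map_of_mem _ hf) hu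
    rw [h1, h2]

/-- Rees-filtration form: agreement of the degree-`d` filtration pieces on the charts forces `J_d = 𝒥_d`. [OURS · L1 W4.5c] -/
theorem rees_ideal_eq_of_agree {ι : Type*} (O : ι → X.Opens) (hO : ∀ i, IsAffineOpen (O i)) (J : ReesFiltration X) {d : ℕ}
    (hagree : ∀ i, (J.filtration ⟨O i, hO i⟩).ideal d = (c.rees.filtration ⟨O i, hO i⟩).ideal d)
    (hJ : ((J.ideal d).support : Set X) ⊆ ⋃ i, (O i : Set X)) (hξ : closure {ξ} ⊆ ⋃ i, (O i : Set X)) : J.ideal d = c.rees.ideal d :=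
  c.eq_valIdealSheaf_of_agree O hO (J.ideal d) (fun i => hagree i) hJ hξ

end Valuative.CentredVal

namespace AuxValuative

section Model

variable {p : ℕ} {X' X₁ : Scheme.{0}} {q : X' ⟶ X₁} {G : Type} [Group G] {ρ : G →* Aut X'} {g₀ : G}

/-- **`AuxValAt M`** (OURS CANDIDATE research statement, asserted nowhere; the A side as ONE CENTRED VALUATION): a BAD point `ξ`, a valuation centred at
`ξ`, a degree `d > 0` and finitely many `G`-stable affine CENTRE charts of its valuative Rees filtration covering `closure {ξ}`; a top-dimensional
component of `nonKillable M` inside `closure {ξ}`; and along every move of the valuative filtration in degree `d` (its weighted blow-up), every bad point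
over `closure {ξ}` is KILLABLE. [OURS · L1 W4.5c] -/
def _root_.Summit.ResolutionOfSingularities.ResolutionOfSingularities.Theorems.WildQuotientResolution.S1.GameFrame.GModel.AuxValAt
    (M : GameFrame.GModel p q G ρ g₀) : Prop :=
  ∃ (ξ : M.V) (c : CentredVal M.V ξ) (n : ℕ) (O : Fin n → M.act.StableAffineOpens) (d : ℕ), 0 < d ∧
    (∀ i, IsCentreChart p M.act g₀ c.rees d (O i)) ∧
    closure {ξ} ⊆ ⋃ i, ((O i).1 : Set M.V) ∧ ξ ∈ M.badLocus ∧
    (∃ t ∈ irreducibleComponents ↥M.nonKillable, topologicalKrullDim ↥t = M.jInf ∧ Subtype.val '' t ⊆ closure {ξ}) ∧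
    ∀ (M' : GameFrame.GModel p q G ρ g₀) (π' : M'.V ⟶ M.V), IsBlowup π' (c.rees.ideal d) → M'.π = π' ≫ M.π → M'.r = π' ≫ M.r →
      (∀ g : G, (M'.act.aut g).hom ≫ π' = π' ≫ (M.act.aut g).hom) →
      ∀ v' ∈ M'.badLocus, π'.base v' ∈ closure {ξ} → M'.KillableAt v'

/-- ★★ **THE VALUATIVE A CERTIFICATE IMPLIES THE CHARTWISE CUT**: `AuxValAt M ⇒ AuxChartsAt M`. [OURS · L1 W4.5c] -/
theorem auxChartsAt_of_auxValAt (M : GameFrame.GModel p q G ρ g₀) (h : M.AuxValAt) : M.AuxChartsAt := by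
  obtain ⟨ξ, c, n, O, d, hd, hc, hcov, hξ, ⟨t, ht, hdt, htsub⟩, hkill⟩ := h
  have hsupp : ((c.rees.ideal d).support : Set M.V) = closure {ξ} := c.support_rees_ideal_eq hd
  have hclbad : closure {ξ} ⊆ M.badLocus := closure_minimal (Set.singleton_subset_iff.2 hξ) M.isClosed_badLocus
  refine ⟨n, O, fun _ => c.rees, d, hd, hc, fun _ _ _ _ _ _ => rfl, fun i => ?_, fun i => ?_, ⟨t, ht, hdt, fun v hv => ?_⟩,
    fun J _ hJfil hJcov M' π' hbl hπ hr hcomm v' hv' hvs => ?_⟩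
  · exact (closure_mono Set.inter_subset_left).trans ((c.rees.ideal d).support.isClosed.closure_eq.le.trans (hsupp.le.trans hcov))
  · exact Set.inter_subset_left.trans (hsupp.le.trans hclbad)
  · have hvξ : v ∈ closure {ξ} := htsub hv
    obtain ⟨i, hvi⟩ := Set.mem_iUnion.mp (hcov hvξ)
    exact Set.mem_iUnion.mpr ⟨i, hsupp.symm ▸ hvξ, hvi⟩
  · have hJd : J.ideal d = c.rees.ideal d :=
      c.rees_ideal_eq_of_agree (fun i => (O i).1) (fun i => (hc i).1) J (fun i => hJfil i (hc i).1 d) hJcov hcov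
    rw [hJd] at hbl hvs
    rw [hsupp] at hvs
    exact hkill M' π' hbl hπ hr hcomm v' hv' hvs

/-- Every irreducible component of `nonKillable M`, read in `V`, has a generic point (schemes are sober). -/
theorem exists_isGenericPoint_component (M : GameFrame.GModel p q G ρ g₀) {t : Set ↥M.nonKillable} (ht : t ∈ irreducibleComponents ↥M.nonKillable) :
    ∃ ξ : M.V, IsGenericPoint ξ (Subtype.val '' t : Set M.V) :=
  have hcl : IsClosed (Subtype.val '' t : Set M.V) :=
    M.isClosed_nonKillable.isClosedEmbedding_subtypeVal.isClosedMap _ (isClosed_of_mem_irreducibleComponents t ht)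
  have hirr : IsIrreducible (Subtype.val '' t : Set M.V) := ht.1.image _ continuous_subtype_val.continuousOn
  ⟨hirr.genericPoint, hirr.isGenericPoint_genericPoint hcl⟩

/-- ★ **Component form of the valuative A certificate**: with `ξ` the generic point of a top-dimensional component `t` of `nonKillable M` (read in `V`),
`closure {ξ} = t` and `ξ` is bad, so `AuxValAt M` follows from: centre charts of a valuation centred at `ξ` covering `t`, and killability of every bad
point over `t` along the valuation's degree-`d` moves. [OURS · L1 W4.5c] -/
theorem auxValAt_of_component (M : GameFrame.GModel p q G ρ g₀) {t : Set ↥M.nonKillable} (ht : t ∈ irreducibleComponents ↥M.nonKillable)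
    (hdt : topologicalKrullDim ↥t = M.jInf) {ξ : M.V} (hξ : IsGenericPoint ξ (Subtype.val '' t : Set M.V)) (c : CentredVal M.V ξ)
    {n : ℕ} (O : Fin n → M.act.StableAffineOpens) {d : ℕ} (hd : 0 < d) (hc : ∀ i, IsCentreChart p M.act g₀ c.rees d (O i))
    (hcov : (Subtype.val '' t : Set M.V) ⊆ ⋃ i, ((O i).1 : Set M.V))
    (hkill : ∀ (M' : GameFrame.GModel p q G ρ g₀) (π' : M'.V ⟶ M.V), IsBlowup π' (c.rees.ideal d) → M'.π = π' ≫ M.π → M'.r = π' ≫ M.r →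
      (∀ g : G, (M'.act.aut g).hom ≫ π' = π' ≫ (M.act.aut g).hom) →
      ∀ v' ∈ M'.badLocus, π'.base v' ∈ (Subtype.val '' t : Set M.V) → M'.KillableAt v') : M.AuxValAt := by
  have hcl : closure {ξ} = (Subtype.val '' t : Set M.V) := isGenericPoint_def.1 hξ
  have hξbad : ξ ∈ M.badLocus := by
    obtain ⟨z, -, hzξ⟩ := hξ.mem
    rw [← hzξ]
    exact M.nonKillable_subset_badLocus z.2
  refine ⟨ξ, c, n, O, d, hd, hc, ?_, hξbad, ⟨t, ht, hdt, ?_⟩, fun M' π' hbl hπ hr hcomm v' hv' hvs => ?_⟩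
  · rw [hcl]; exact hcov
  · rw [hcl]
  · rw [hcl] at hvs
    exact hkill M' π' hbl hπ hr hcomm v' hv' hvs

/-- **`AuxValWithin n M`**: the bounded-sequence recursion of `AuxChartsWithin` / `AuxOrbitWithin` with `AuxValAt` leaves. [OURS · L1 W4.5c · CANDIDATE] -/
def _root_.Summit.ResolutionOfSingularities.ResolutionOfSingularities.Theorems.WildQuotientResolution.S1.GameFrame.GModel.AuxValWithin :
    ℕ → GameFrame.GModel p q G ρ g₀ → Prop
  | 0, M => M.AuxValAt
  | n + 1, M => M.AuxValAt ∨
      ∃ (𝒦 : ReesFiltration M.V) (d : ℕ), IsAuxCentre p M.act g₀ 𝒦 d (M.badLocus)ᶜ ∧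
        ∀ M' : GameFrame.GModel p q G ρ g₀, M.IsMoveOf M' 𝒦 d →
          (M'.jInf < M.jInf ∨ (M'.jInf = M.jInf ∧ M'.topCount ≤ M.topCount)) ∧ GameFrame.GModel.AuxValWithin n M'

/-- `AuxValWithin n ⇒ AuxChartsWithin n`. [OURS · L1 W4.5c] -/
theorem auxChartsWithin_of_auxValWithin :
    ∀ (n : ℕ) (M : GameFrame.GModel p q G ρ g₀), M.AuxValWithin n → M.AuxChartsWithin n
  | 0, M, h => auxChartsAt_of_auxValAt M h
  | n + 1, M, h => by
      rcases h with h | ⟨𝒦, d, haux, hmv⟩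
      · exact Or.inl (auxChartsAt_of_auxValAt M h)
      · exact Or.inr ⟨𝒦, d, haux, fun M' hm => ⟨(hmv M' hm).1, auxChartsWithin_of_auxValWithin n M' (hmv M' hm).2⟩⟩

end Model

/-! ## Datum form -/

/-- **`AuxValWithinReach p`** (OURS CANDIDATE research statement, asserted nowhere): at every non-terminal model AUX-reachable from the initial model of a
crux datum with `jInf ≠ ⊥`, `∃ n, AuxValWithin n M` — a bounded one-orbit aux sequence whose final step is a VALUATIVE certificate (`AuxValAt`).
Implies the registered `AuxWithinReachAux p` (`auxWithinReachAux_of_auxValWithinReach`). [OURS · L1 W4.5c] -/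
def AuxValWithinReach (p : ℕ) : Prop :=
  ∀ (k : Type) [Field k] [CharP k p] [PerfectField k] (X' X₁ : Scheme.{0})
    (f : X₁ ⟶ Spec (.of k)) (q : X' ⟶ X₁) (G : Type) [Group G] [Finite G]
    (ρ : G →* Aut X'), Nat.card G = p → IsSeparated f → LocallyOfFiniteType f → QuasiCompact f →
    IsIntegral X₁ → ∀ [IsIntegral X'], Scheme.IsRegular X' → IsFinite q → Function.Surjective q.base →
    (∃ U : X₁.Opens, Dense (U : Set X₁) ∧ Etale (q ∣_ U)) →
    ∀ (hq : ∀ g : G, (ρ g).hom ≫ q = q),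
    (∀ x y : X', q.base x = q.base y → ∃ g : G, (ρ g).hom.base x = y) →
    topologicalKrullDim X₁ ≤ 4 → Function.Injective ρ →
    ∀ (g₀ : G), (∀ g : G, g ∈ Subgroup.zpowers g₀) → ∀ [IsLocallyNoetherian X']
      (h₀ : NodeAtlas p (⟨ρ, hq⟩ : ActionOver q G) g₀),
      ∀ M : GameFrame.GModel p q G ρ g₀, (GameFrame.GModel.initial hq h₀).ReachableAux M → ¬ M.Terminal →
        M.jInf ≠ ⊥ → ∃ n : ℕ, M.AuxValWithin n

/-- ★★ **The valuative A statement implies the registered A stub**: `AuxValWithinReach p ⇒ AuxWithinReachAux p` (`Or.inr`, via `AuxChartsWithin` and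
`AuxOrbitWithin`). [OURS · L1 W4.5c] -/
theorem auxWithinReachAux_of_auxValWithinReach {p : ℕ} (h : AuxValWithinReach p) : AuxWithinReachAux p := by
  intro k _ _ _ X' X₁ f q G _ _ ρ hG hfs hfft hfqc hX₁ _ hreg hqfin hqs hqet hq horb hdim hinj g₀ hg₀ _ h₀ M hR hT hj
  haveI := hfs
  haveI := hqfin
  obtain ⟨n, hn⟩ := h k X' X₁ f q G ρ hG hfs hfft hfqc hX₁ hreg hqfin hqs hqet hq horb hdim hinj g₀ hg₀ h₀ M hR hT hj
  exact Or.inr ⟨n, Model.auxOrbitWithin_of_auxChartsWithin hg₀ (fun M => isSeparated_of_datum f M) n M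
    (auxChartsWithin_of_auxValWithin n M hn)⟩

end AuxValuative

end Summit.ResolutionOfSingularities.ResolutionOfSingularities.Theorems.WildQuotientResolution.S1

end
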